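import Literature.NumberTheory.EllipticCurves.HasseWeilAbelianConductorSwanIndependenceTwoProofs
import Literature.NumberTheory.EllipticCurves.SwanConductorTorsionDichotomyProofs
import Literature.NumberTheory.EllipticCurves.QuadraticBaseChangeGaloisProofs
import Literature.NumberTheory.GaloisRepresentations.SqrtUpperRamificationProofs
import HarnessLib

/-!
# The wild conductor of a quadratic twist of a curve with tame `ℓ`-torsion; inertia above `2`
# fixes `√d` for `d ≡ 1 (mod 4)`

`Proofs` file (theorems only, no definitions, no named facts) in topic
`NumberTheory/EllipticCurves`, landed by the seat of bsd.S15
(`Literature.NumberTheory.EllipticCurves.conductorNorm_eq_artinConductorNat`) as Galois-side tools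
for the one remaining leaf of Ogg–Saito over `ℚ` (Silverman, *ATAEC*, Thm. IV.11.1 at `p = 2` for
the additive, potentially good curves with `ord₂(j) > 0`; see
`OggFormulaPotGoodOrdinaryTwoProofs`, `HasseWeilAbelianConductorNatOfPotGoodTwoProofs`).

The twist mechanism of the proof of *ATAEC* Thm. IV.10.2(b) (PDF pp. 359–360) — `E = E₀ ⊗ χ_d`,
so `δ(E) = 2δ(χ_d)` as soon as `E₀` is tame — was run in the tree with `E₀ = E^{(d)}`
multiplicative (`forall_smul_geomTorsion_eq_iff_le_stabilizer_of_quadraticTwist`,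
`HasseWeilAbelianConductorSwanIndependenceTwoProofs`; the curves with `ord₂(j) < 0`) and good
(`…_of_hasGoodReductionAt`, `OggFormulaPotGoodOrdinaryTwoProofs`; `ord₂(j) = 0`).  Both proofs use
of `E₀` only that the wild ramification group `Γ_K^u(𝔓)` fixes `E₀[ℓ]`.  This file states the
mechanism at that level, so that it applies to every *tame partner* `E₀` — in particular to a
partner with a `K`-rational point of order `ℓ`, whose `ℓ`-torsion is fixed by every wild
ramification group by the dichotomy of `SwanConductorTorsionDichotomyProofs` (a wild ramification
group fixing one non-zero point of `E[ℓ]` fixes `E[ℓ]`):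

* `forall_smul_geomTorsion_eq_iff_le_stabilizer_of_forall_smul_geomTorsion_quadraticTwist_eq` —
  if `Γ_K^u(𝔓)` fixes `E^{(d)}[ℓ]` (`ℓ` odd, `d ≠ 0`), then it fixes `E[ℓ]` iff it fixes `√d`;
* `swanConductorAt_rationalTate_eq_two_mul_volume_smul_geomSqrt_ne_of_forall_smul_geomTorsion_quadraticTwist_eq` —
  consequently `Sw_𝔓(V_ℓ E) = 2 · vol {u > 0 : Γ_K^u(𝔓) moves √d}` when every `Γ_K^u(𝔓)`, `u > 0`,
  fixes `E^{(d)}[ℓ]` (`𝔓 ∣ v ∤ ℓ`);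
* `forall_smul_geomTorsion_eq_of_forall_smul_eq_of_ne_zero`,
  `swanConductorAt_rationalTate_eq_zero_of_forall_smul_eq_of_ne_zero` — a curve with a
  `Γ_K`-fixed non-zero `ℓ`-torsion point (e.g. a `K`-rational point of order `ℓ`) has every
  `Γ_K^u(𝔓)` (`u > 0`, `𝔓 ∤ ℓ`) fixing `E[ℓ]`, and `Sw_𝔓(V_ℓ E) = 0`;
* over `ℚ`: `Rat.smul_geomSqrt_eq_of_mem_inertia_of_emod_four_eq_one` — `I_𝔓` (`𝔓 ∣ 2`) fixes
  `√d` for `d ≡ 1 (mod 4)` (`(1 + √d)/2 ∈ ar ℤ`), and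
  `Rat.volume_real_setOf_smul_sqrt_ne_of_emod_four_eq_one` — `vol {u > 0 : Γ_ℚ^u(𝔓) moves √d} = 0`
  for such `d`, completing the values `1` (`d ≡ 3`) and `2` (`d ≡ 2 (mod 4)`) of
  `SqrtUpperRamificationProofs`: the Swan conductor of `χ_d` at `2` is `0, 1, 2`.

Intended use (next files of this seat): the curves `y² = x³ + k` over `ℚ` (`j = 0`), whose
`3`-torsion contains `(0, ±√k)`, so that `Γ^u` fixes `E[3]` iff it fixes `√k` and
`Sw₂(V_ℓ E) = 2 · vol {u > 0 : Γ^u moves √k} ∈ {0, 2, 4}`.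

## References

* J. H. Silverman, *Advanced Topics in the Arithmetic of Elliptic Curves*, GTM 151 (1994), §IV.10,
  Thm. 10.2(b) and its proof (PDF pp. 358–362). [SilvermanATAEC1994]
* J. H. Silverman, *The Arithmetic of Elliptic Curves*, 2nd ed. (2009), X.5 Cor. 5.4 (quadratic
  twists). [SilvermanAEC2009]
* J.-P. Serre, *Local Fields*, GTM 67 (1979), Ch. IV §§1–3, Ch. VI §2. [SerreLocalFields1979]
* J.-P. Serre, J. Tate, *Good reduction of abelian varieties*, Ann. of Math. 88 (1968), §3.
  [SerreTate1968]

## Design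

Theorems only; `noncomputable section`; one universe `u`.  §1 in `namespace WeierstrassCurve`
(dot-notation companions, signatures of `HasseWeilAbelianConductorSwanIndependenceTwoProofs`); §2
in `namespace Literature.NumberTheory.GaloisRepresentations` next to the `Rat.…` lemmas of
`SqrtUpperRamificationProofs`.  Axioms: `propext`, `Classical.choice`, `Quot.sound`.
-/

noncomputable section

open scoped Classical NumberField
open IsDedekindDomain Field Literature.NumberTheory.EllipticCurves
  Literature.NumberTheory.GaloisRepresentations Polynomial

universe u

/-! ## §1. Quadratic twists of a curve with tame `ℓ`-torsion -/

namespace WeierstrassCurve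

section NumberField

variable {K : Type u} [Field K] [NumberField K] (W : WeierstrassCurve K) (ℓ : ℕ) [Fact ℓ.Prime]

/-- **`Γ_K^u(𝔓)` fixes `E[ℓ]` iff it fixes `√d`, as soon as it fixes `E^{(d)}[ℓ]`** (`ℓ` odd).
Let `E/K` be an elliptic curve over a number field, `ℓ` an odd prime, `d ≠ 0`, `𝔓` a prime of
`\bar ℤ_K` and `u` a real number, and suppose the ramification group `Γ_K^u(𝔓)` fixes the
`ℓ`-torsion of the quadratic twist `E' = E^{(d)}` pointwise.  Then `Γ_K^u(𝔓)` fixes `E[ℓ]`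
pointwise iff `Γ_K^u(𝔓) ≤ Γ_{K(√d)}`.  Proof: along `f : E'(K̄) ≃ E(K̄)` with `f(σP) = ±σf(P)`
according to `σ√d = ±√d` (`exists_addEquiv_geomPoints_quadraticTwist_sign`, *AEC* X.5 Cor. 5.4)
an element `σ ∈ Γ^u` acts on `E[ℓ]` as `±1`, and `-1 ≠ 1` on `E[ℓ] ≠ 0` for `ℓ` odd.  (Only the
action on `E'[ℓ]` enters; the cases `E'` good, resp. multiplicative at the place below `𝔓` are
`…_of_hasGoodReductionAt` (`OggFormulaPotGoodOrdinaryTwoProofs`), resp.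
`forall_smul_geomTorsion_eq_iff_le_stabilizer_of_quadraticTwist`
(`HasseWeilAbelianConductorSwanIndependenceTwoProofs`), whose proof this is.)  This is the twist
argument of Silverman *ATAEC* Thm. IV.10.2(b) (PDF pp. 359–360) at finite level `ℓ`.
[cite: SilvermanATAEC1994, Thm. IV.10.2(b) and proof (PDF pp. 358–360)]
[cite: SilvermanAEC2009, X.5 Cor. 5.4] -/
theorem forall_smul_geomTorsion_eq_iff_le_stabilizer_of_forall_smul_geomTorsion_quadraticTwist_eq
    [W.IsElliptic] (hℓ2 : ℓ ≠ 2) {d : K} (hd : d ≠ 0)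
    {𝔓 : Ideal (absIntegers (𝓞 K) K)} {u : ℝ}
    (hfix : ∀ σ ∈ absUpperRamificationSubgroup (𝓞 K) 𝔓 u,
      ∀ T' : geomTorsion (W.quadraticTwist d) ℓ, σ • T' = T') :
    (∀ σ ∈ absUpperRamificationSubgroup (𝓞 K) 𝔓 u, ∀ T : geomTorsion W ℓ, σ • T = T) ↔
      absUpperRamificationSubgroup (𝓞 K) 𝔓 u ≤
        MulAction.stabilizer (absoluteGaloisGroup K) (geomSqrt d) := by
  obtain ⟨f, hfpos, hfneg⟩ := W.exists_addEquiv_geomPoints_quadraticTwist_sign hd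
  -- `f⁻¹ T` is an `ℓ`-torsion point of `E'`, hence fixed by `Γ^u`
  have hmem : ∀ T : geomTorsion W ℓ,
      f.symm (T : geomPoints W) ∈ geomTorsion (W.quadraticTwist d) ℓ := fun T ↦ by
    rw [AddSubgroup.torsionBy.nsmul_iff]
    apply f.injective
    rw [map_nsmul, AddEquiv.apply_symm_apply, map_zero]
    exact AddSubgroup.torsionBy.nsmul_iff.mp T.2
  have hfix' : ∀ σ ∈ absUpperRamificationSubgroup (𝓞 K) 𝔓 u, ∀ T : geomTorsion W ℓ,
      σ • f.symm (T : geomPoints W) = f.symm (T : geomPoints W) := fun σ hσ T ↦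
    congrArg Subtype.val (hfix σ hσ ⟨f.symm (T : geomPoints W), hmem T⟩)
  constructor
  · intro H σ hσ
    by_contra hσN
    rw [MulAction.mem_stabilizer_iff] at hσN
    have hneg : σ • geomSqrt d = -geomSqrt d :=
      (map_geomSqrt (absoluteGaloisGroup.toAlgEquiv K σ) d).resolve_left hσN
    -- a non-zero `ℓ`-torsion point
    have hcard : Nat.card (geomTorsion W ℓ) = ℓ ^ 2 :=
      card_torsionPoints_eq_sq_holds W (AlgebraicClosure K) (n := ℓ)
        (by exact_mod_cast (Fact.out : ℓ.Prime).ne_zero)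
    haveI : Finite (geomTorsion W ℓ) := Nat.finite_of_card_ne_zero (by
      rw [hcard]; exact pow_ne_zero 2 (Fact.out : ℓ.Prime).ne_zero)
    have hnt : Nontrivial (geomTorsion W ℓ) := by
      rw [← Finite.one_lt_card_iff_nontrivial, hcard]
      exact Nat.one_lt_pow two_ne_zero (Fact.out : ℓ.Prime).one_lt
    obtain ⟨T, hT0⟩ := exists_ne (0 : geomTorsion W ℓ)
    -- `σ T = -T`
    have hσT : σ • (T : geomPoints W) = -(T : geomPoints W) := by
      have h1 := hfneg σ hneg (f.symm T)
      rw [hfix' σ hσ T, AddEquiv.apply_symm_apply] at h1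
      exact neg_eq_iff_eq_neg.mp h1.symm
    have hσT' : σ • (T : geomPoints W) = T := congrArg Subtype.val (H σ hσ T)
    -- so `2T = 0` and `ℓT = 0` with `ℓ` odd: `T = 0`
    have h2T : (2 : ℤ) • (T : geomPoints W) = 0 := by
      rw [two_zsmul]
      nth_rewrite 2 [← hσT']
      rw [hσT, add_neg_cancel]
    have hℓT' : (ℓ : ℤ) • (T : geomPoints W) = 0 := (Submodule.mem_torsionBy_iff _ _).mp T.2
    exact hT0 (Subtype.ext
      (eq_zero_of_odd_of_smul_eq_zero ((Fact.out : ℓ.Prime).odd_of_ne_two hℓ2) hℓT' h2T))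
  · intro H σ hσ T
    apply Subtype.ext
    have hσN : σ • geomSqrt d = geomSqrt d := MulAction.mem_stabilizer_iff.mp (H hσ)
    have h1 := hfpos σ hσN (f.symm T)
    rw [hfix' σ hσ T, AddEquiv.apply_symm_apply] at h1
    exact h1.symm

/-- **The wild conductor of a ramified quadratic twist of a curve whose `ℓ`-torsion is tame.**
For an elliptic `W/K` over a number field, an odd prime `ℓ`, a place `v ∌ ℓ`, `d ≠ 0` such that
every wild ramification group `Γ_K^u(𝔓)` (`u > 0`) fixes the `ℓ`-torsion of `W^{(d)}` pointwise
(e.g. `W^{(d)}` good or multiplicative at `v`, or with a `K`-rational point of order `ℓ`,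
`forall_smul_geomTorsion_eq_of_exists_rational`), and `𝔓 ∣ v`:
`Sw_𝔓(V_ℓ E) = 2 · vol {u > 0 : some σ ∈ Γ_K^u(𝔓) has σ√d ≠ √d}` — the Swan conductor is
the integral of `codim (V_ℓ E)^{Γ^u} ∈ {0, 2}` (`swanConductorAt_rationalTate_eq_two_mul_volume`),
and `Γ^u` fixes `E[ℓ]` iff it fixes `√d`.  This is `δ(E) = 2δ(χ_d)` for `E = E₀ ⊗ χ_d` with
`E₀[ℓ]` tame, the twist mechanism of Silverman *ATAEC* Thm. IV.10.2(b) combined with the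
conductor of the twisting character.
[cite: SilvermanATAEC1994, Thm. IV.10.2(b),(c) and proof (PDF pp. 358–362)] -/
theorem swanConductorAt_rationalTate_eq_two_mul_volume_smul_geomSqrt_ne_of_forall_smul_geomTorsion_quadraticTwist_eq
    [W.IsElliptic]
    (h : Continuous fun x : absoluteGaloisGroup K × RationalTateModule (geomPoints W) ℓ ↦
      rationalTateRepresentation (absoluteGaloisGroup K) (geomPoints W) ℓ x.1 x.2)
    {v : HeightOneSpectrum (𝓞 K)} (hℓ : (ℓ : 𝓞 K) ∉ v.asIdeal) (hℓ2 : ℓ ≠ 2)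
    {d : K} (hd : d ≠ 0) {𝔓 : Ideal (absIntegers (𝓞 K) K)} (h𝔓 : 𝔓 ∈ v.primesAbove)
    (hfix : ∀ u : ℝ, 0 < u → ∀ σ ∈ absUpperRamificationSubgroup (𝓞 K) 𝔓 u,
      ∀ T' : geomTorsion (W.quadraticTwist d) ℓ, σ • T' = T') :
    (rationalTateGaloisRepOf (geomPoints W) ℓ h).swanConductorAt (𝓞 K) 𝔓 =
      2 * MeasureTheory.volume.real {u : ℝ | 0 < u ∧
        ∃ σ ∈ absUpperRamificationSubgroup (𝓞 K) 𝔓 u, σ • geomSqrt d ≠ geomSqrt d} := by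
  rw [W.swanConductorAt_rationalTate_eq_two_mul_volume ℓ h hℓ h𝔓]
  congr 2
  ext u
  simp only [Set.mem_setOf_eq]
  refine and_congr_right fun hu ↦ ?_
  have key :=
    W.forall_smul_geomTorsion_eq_iff_le_stabilizer_of_forall_smul_geomTorsion_quadraticTwist_eq ℓ
      hℓ2 hd (hfix u hu)
  constructor
  · rintro ⟨σ, hσ, T, hT⟩
    by_contra hno
    push Not at hno
    have hle : absUpperRamificationSubgroup (𝓞 K) 𝔓 u ≤
        MulAction.stabilizer (absoluteGaloisGroup K) (geomSqrt d) :=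
      fun τ hτ ↦ MulAction.mem_stabilizer_iff.mpr (hno τ hτ)
    exact hT (key.mpr hle σ hσ T)
  · rintro ⟨σ, hσ, hne⟩
    by_contra hno
    push Not at hno
    exact hne (MulAction.mem_stabilizer_iff.mp (key.mp (fun τ hτ T ↦ hno τ hτ T) hσ))

/-- **A wild ramification group fixes the `ℓ`-torsion of a curve with a rational point of order
`ℓ`.**  For an elliptic `W/K` over a number field, a prime `𝔓 ∣ v ∤ ℓ` of `\bar ℤ_K`, `u > 0` and a
non-zero `ℓ`-torsion point `P ∈ E(K̄)[ℓ]` fixed by all of `Γ_K` (e.g. a `K`-rational point of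
order `ℓ`): `Γ_K^u(𝔓)` fixes `E[ℓ]` pointwise — the wild ramification groups act on `E[ℓ]`
either trivially or without non-zero fixed points
(`forall_smul_geomTorsion_eq_of_smul_eq_of_ne_zero_of_mem_absUpperRamificationSubgroup`,
`SwanConductorTorsionDichotomyProofs`).  In particular `K(E[ℓ])/K` is tamely ramified above `v`
and `Sw_𝔓(V_ℓ E) = 0` (`swanConductorAt_rationalTate_eq_zero_of_forall_smul_geomTorsion_eq`).
[cite: SilvermanATAEC1994, proof of Thm. IV.11.1 for p = 3 (PDF p. 370)]
[cite: SerreLocalFields1979, Ch. IV §2 Cor. 3 of Prop. 7] -/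
theorem forall_smul_geomTorsion_eq_of_forall_smul_eq_of_ne_zero [W.IsElliptic]
    {v : HeightOneSpectrum (𝓞 K)} (hℓ : (ℓ : 𝓞 K) ∉ v.asIdeal)
    {𝔓 : Ideal (absIntegers (𝓞 K) K)} (h𝔓 : 𝔓 ∈ v.primesAbove) {u : ℝ} (hu : 0 < u)
    {P : geomTorsion W ℓ} (hP0 : P ≠ 0) (hP : ∀ σ : absoluteGaloisGroup K, σ • P = P) :
    ∀ σ ∈ absUpperRamificationSubgroup (𝓞 K) 𝔓 u, ∀ T : geomTorsion W ℓ, σ • T = T :=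
  W.forall_smul_geomTorsion_eq_of_smul_eq_of_ne_zero_of_mem_absUpperRamificationSubgroup ℓ hℓ h𝔓
    hu hP0 fun σ _ ↦ hP σ

/-- **`Sw_𝔓(V_ℓ E) = 0` for a curve with a `Γ_K`-fixed non-zero `ℓ`-torsion point** (`𝔓 ∣ v ∤ ℓ`):
the wild ramification groups fix `E[ℓ]`, and the Swan conductor of `V_ℓ E` is that of `E[ℓ]`
(`swanConductorAt_rationalTate_eq_zero_of_forall_smul_geomTorsion_eq`, Serre–Tate §3).
[cite: SerreTate1968, §3] [cite: SilvermanATAEC1994, §IV.10 Definition of δ (PDF p. 358)] -/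
theorem swanConductorAt_rationalTate_eq_zero_of_forall_smul_eq_of_ne_zero [W.IsElliptic]
    (h : Continuous fun x : absoluteGaloisGroup K × RationalTateModule (geomPoints W) ℓ ↦
      rationalTateRepresentation (absoluteGaloisGroup K) (geomPoints W) ℓ x.1 x.2)
    {v : HeightOneSpectrum (𝓞 K)} (hℓ : (ℓ : 𝓞 K) ∉ v.asIdeal)
    {𝔓 : Ideal (absIntegers (𝓞 K) K)} (h𝔓 : 𝔓 ∈ v.primesAbove)
    {P : geomTorsion W ℓ} (hP0 : P ≠ 0) (hP : ∀ σ : absoluteGaloisGroup K, σ • P = P) :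
    (rationalTateGaloisRepOf (geomPoints W) ℓ h).swanConductorAt (𝓞 K) 𝔓 = 0 :=
  W.swanConductorAt_rationalTate_eq_zero_of_forall_smul_geomTorsion_eq ℓ h hℓ h𝔓
    fun _ hu ↦ W.forall_smul_geomTorsion_eq_of_forall_smul_eq_of_ne_zero ℓ hℓ h𝔓 hu hP0 hP

end NumberField

end WeierstrassCurve

/-! ## §2. Over `ℚ`: inertia above `2` fixes `√d` for `d ≡ 1 (mod 4)` -/

namespace Literature.NumberTheory.GaloisRepresentations

open _root_.WeierstrassCurve

variable {v : HeightOneSpectrum (𝓞 ℚ)}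

/-- **Inertia above `2` fixes `√d` for `d ≡ 1 (mod 4)`** (`ℚ(√d)/ℚ` is unramified at `2`).  With
`d = 4q + 1`, `θ = (1 + √d)/2` is a root of the monic integral `X² - X - q`, so `θ ∈ \bar ℤ`; for
`σ ∈ I_𝔓`, `𝔓 ∣ 2`, `σθ - θ ∈ 𝔓`, and if `σ√d = -√d` then `σθ - θ = -√d`, whence `d = (√d)² ∈ 𝔓`,
`2 ∣ d` — impossible.  Neukirch, *Algebraic Number Theory*, Ch. I §8 (the ring of integers of a
quadratic field) with Ch. I §9 (inertia); Serre, *Local Fields*, Ch. IV §1. [folklore] -/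
theorem Rat.smul_geomSqrt_eq_of_mem_inertia_of_emod_four_eq_one {d : ℤ} (hd : d % 4 = 1)
    (hv : (2 : 𝓞 ℚ) ∈ v.asIdeal) {𝔓 : Ideal (absIntegers (𝓞 ℚ) ℚ)} (h𝔓 : 𝔓 ∈ v.primesAbove)
    {σ : absoluteGaloisGroup ℚ} (hσ : σ ∈ 𝔓.inertia (absoluteGaloisGroup ℚ)) :
    σ • geomSqrt (d : ℚ) = geomSqrt (d : ℚ) := by
  haveI : 𝔓.IsPrime := h𝔓.1
  set s : AlgebraicClosure ℚ := geomSqrt (d : ℚ) with hs_def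
  have hs : s ^ 2 = (d : AlgebraicClosure ℚ) := by
    rw [hs_def, geomSqrt_sq, map_intCast]
  obtain ⟨q, hq⟩ : ∃ q : ℤ, d = 4 * q + 1 := ⟨(d - 1) / 4, by omega⟩
  rcases smul_geomSqrt_eq_or σ (d : ℚ) with h | hneg
  · exact h
  exfalso
  -- `θ = (1 + s)/2`, a root of `X² - X - q`
  set θ : AlgebraicClosure ℚ := (1 + s) / 2 with hθ
  have hθeq : θ ^ 2 - θ - (q : AlgebraicClosure ℚ) = 0 := by
    have e : θ ^ 2 - θ - (q : AlgebraicClosure ℚ) = (s ^ 2 - (4 * q + 1)) / 4 := by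
      rw [hθ]; ring
    rw [e, hs, hq]; push_cast; ring
  have hθint : IsIntegral (𝓞 ℚ) θ := by
    refine ⟨X ^ 2 - (X + C (q : 𝓞 ℚ)), (monic_X_pow 2).sub_of_left ?_, ?_⟩
    · refine lt_of_le_of_lt (degree_add_le _ _) ?_
      rw [degree_X_pow]
      refine max_lt ?_ (lt_of_le_of_lt degree_C_le ?_)
      · rw [degree_X]; exact_mod_cast Nat.one_lt_two
      · exact_mod_cast Nat.zero_lt_two
    · rw [eval₂_sub, eval₂_add, eval₂_pow, eval₂_X, eval₂_C, ← hθeq]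
      simp only [map_intCast]
      ring
  have hsint : IsIntegral (𝓞 ℚ) s := by
    refine IsIntegral.of_pow two_pos ?_
    rw [hs, show (d : AlgebraicClosure ℚ) = algebraMap (𝓞 ℚ) (AlgebraicClosure ℚ) (d : 𝓞 ℚ) by
      rw [map_intCast]]
    exact isIntegral_algebraMap
  set x : absIntegers (𝓞 ℚ) ℚ := ⟨θ, hθint⟩ with hx
  set y : absIntegers (𝓞 ℚ) ℚ := ⟨s, hsint⟩ with hy
  have hσθ : σ • θ = (1 - s) / 2 := by
    have h1 : σ • θ = (1 + σ • s) / 2 := by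
      change absoluteGaloisGroup.toAlgEquiv ℚ σ θ = (1 + absoluteGaloisGroup.toAlgEquiv ℚ σ s) / 2
      rw [hθ, map_div₀, map_add, map_one, map_ofNat]
    rw [h1, hneg]; ring
  have hmem : σ • x - x ∈ 𝔓 := hσ x
  have hxy : σ • x - x = -y := Subtype.ext (by
    rw [AddSubgroupClass.coe_sub, integralClosure.coe_smul, NegMemClass.coe_neg]
    change σ • θ - θ = -s
    rw [hσθ, hθ]; ring)
  rw [hxy, neg_mem_iff] at hmem
  have hyy : y * y = algebraMap (𝓞 ℚ) (absIntegers (𝓞 ℚ) ℚ) (d : 𝓞 ℚ) := Subtype.ext (by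
    change s * s = algebraMap (𝓞 ℚ) (AlgebraicClosure ℚ) (d : 𝓞 ℚ)
    rw [← sq, hs, map_intCast])
  have hdmem : algebraMap (𝓞 ℚ) (absIntegers (𝓞 ℚ) ℚ) (d : 𝓞 ℚ) ∈ 𝔓 := by
    rw [← hyy]; exact 𝔓.mul_mem_left _ hmem
  have hdv : ((d : ℤ) : 𝓞 ℚ) ∈ v.asIdeal := by
    rw [h𝔓.2.over, Ideal.under_def, Ideal.mem_comap]; exact hdmem
  rw [Rat.intCast_mem_asIdeal_iff_two_dvd hv] at hdv
  omega

/-- **`vol {u > 0 : Γ_ℚ^u(𝔓) moves √d} = 0` for `d ≡ 1 (mod 4)`, `𝔓 ∣ 2`**: the wild (indeed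
all) ramification groups lie in `I_𝔓` (`absUpperRamificationSubgroup_le_inertia_holds`), which
fixes `√d` (`Rat.smul_geomSqrt_eq_of_mem_inertia_of_emod_four_eq_one`): the quadratic character of
`ℚ(√d)` is unramified at `2`, its Swan conductor there is `0`.  Serre, *Local Fields*, Ch. IV §3,
Ch. VI §2. [cite: SerreLocalFields1979, Ch. IV §3 and Ch. VI §2] -/
theorem Rat.volume_real_setOf_smul_sqrt_ne_of_emod_four_eq_one {d : ℤ} (hd : d % 4 = 1)
    (hv : (2 : 𝓞 ℚ) ∈ v.asIdeal) {𝔓 : Ideal (absIntegers (𝓞 ℚ) ℚ)} (h𝔓 : 𝔓 ∈ v.primesAbove) :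
    MeasureTheory.volume.real
      {w : ℝ | 0 < w ∧ ∃ σ ∈ absUpperRamificationSubgroup (𝓞 ℚ) 𝔓 w,
        σ • geomSqrt (d : ℚ) ≠ geomSqrt (d : ℚ)} = 0 := by
  have he : {w : ℝ | 0 < w ∧ ∃ σ ∈ absUpperRamificationSubgroup (𝓞 ℚ) 𝔓 w,
      σ • geomSqrt (d : ℚ) ≠ geomSqrt (d : ℚ)} = ∅ := by
    ext w
    simp only [Set.mem_setOf_eq, Set.mem_empty_iff_false, iff_false, not_and, not_exists]
    intro _ σ hσ hne
    exact hne (Rat.smul_geomSqrt_eq_of_mem_inertia_of_emod_four_eq_one hd hv h𝔓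
      (absUpperRamificationSubgroup_le_inertia_holds (𝓞 ℚ) 𝔓 w hσ))
  rw [he, MeasureTheory.measureReal_def, MeasureTheory.measure_empty, ENNReal.toReal_zero]

end Literature.NumberTheory.GaloisRepresentations

end
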